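import Literature.MathematicalPhysics.KineticTheory.DiPernaLionsEquicontinuity
import Literature.MathematicalPhysics.KineticTheory.DiPernaLionsSchemeProofs
import Literature.Analysis.FluidPDE.CollisionWeakForm
import HarnessLib

/-!
# Conservation laws and entropy identity of the DiPerna–Lions approximate solutions

Topic: MathematicalPhysics / KineticTheory. Discharge of the two named facts of
`Literature/MathematicalPhysics/KineticTheory/DiPernaLionsScheme` recording CIP 1994 §5.3
Lemma 5.3.1 (3.4)–(3.7) for the smooth rapidly decaying solutions of the truncated, normalised
Boltzmann equation (`IsDiPernaLionsApproximateSolution δ B f`, `δ ≥ 0`, DiPerna–Lions kernel `B`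
of polynomial growth):

* `approximateSolution_conservation_holds` (**(3.4)–(3.6)**): conservation of mass, kinetic
  energy and of the moment of inertia about the free-flight position `∫∫ f |x - t v|²`;
* `approximateSolution_entropy_identity_holds` (**(3.7)**): the `H`-theorem identity
  `H(f(t)) + ∫₀ᵗ ∫∫ ẽ(f) dx dv ds = H(f(0))` with the normalised dissipation (3.24), finite.

With `approximateSolution_apriori_bounds_of` (SchemeProofs) this closes (A2a)–(A2c) of the
decomposition of `diperna_lions`: the approximating scheme (A) now rests on Lemma 5.3.6
(`truncatedProblem_globalExistence`) and the Step-7 approximations (`kernel_approximation`,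
`data_approximation`) only.

## Proof architecture (CIP 1994 p. 142, organised along characteristics)

CIP differentiate `∫∫ f ψ` in time under the integral sign and integrate by parts in `x`. Here the
same identities are obtained without differentiating under the integral sign: for every
characteristic `(x, v)` the truncated equation gives
`d/ds f♯(s) = Q̃_δ(f,f)♯(s)` (`IsDiPernaLionsApproximateSolution.hasDerivAt_sharp`), hence by the
fundamental theorem of calculus `Φ(T) - Φ(0) = ∫₀ᵀ W♯ Q̃♯ ds` for `Φ = ψ f♯` (transport-invariant
`ψ`, `W = ψ`) and for `Φ = f♯ log f♯` (`W = 1 + log f`); integrating over phase space, Fubini on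
`(0,T] × E × E` and the measure-preserving shear `(x, v) ↦ (x + s v, v)` on each slice give
`∫ Φ(T) - ∫ Φ(0) = ∫₀ᵀ ∫∫ W Q̃_δ(f,f) dx dv ds`
(`IsDiPernaLionsApproximateSolution.integral_sub_integral_eq_integral_collision`). On each slice
and for each `x`, the weak formulation of `Literature.Analysis.FluidPDE.CollisionWeakForm` gives
`∫ Q̃ ψ dv = 0` for collision invariants ((3.10) with `φ = 1, |ξ|², |x - tξ|²`) and
`∫ Q̃ (1 + log f) dv = -(1 + δ∫f)⁻¹ D_B(f)` (`φ = ln f`).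

The absolute convergence of every integral comes from the Schwartz bounds of the slices, uniform
on `[0, T]` (`uniform_decay`), the polynomial growth of `B` and of `|log f|`, through the pointwise
decay `|Q̃_δ(f,f)(s,x,v)| ≤ C (1+‖x‖)^{-a} (1+‖v‖)^{-b}` (`exists_abs_truncatedCollisionOp_le`)
and `integrable_one_add_norm`; measurability in `(s, x, v)` is obtained through the time clamp
`s ↦ max s 0` (`measurable_truncatedCollisionOp_clamp`), under which nothing changes for `s ≥ 0`.

## Faithfulness notes

* The statements discharged are exactly the named facts (universe-polymorphic in `E`); nothing is
  weakened. The `ℝ≥0∞`-valued dissipation `eTruncatedEntropyProduction` of (3.7) is identified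
  slice-wise with `ENNReal.ofReal ((1 + δ∫f)⁻¹ D_B(f(s,x,·)))`
  (`eTruncatedEntropyProduction_eq_ofReal`, the entropy-production integrand being integrable for
  Schwartz slices with `|log f|` of polynomial growth), whose integral over `(0,t] × E` is finite.
* This file declares theorems only.

## References

* C. Cercignani, R. Illner, M. Pulvirenti, *The Mathematical Theory of Dilute Gases*, Springer
  (1994), §5.3 Lemma 5.3.1, (3.4)–(3.7) and (3.10), pp. 141–142; (3.16), (3.24).
* P.-L. Lions, *Global solutions of kinetic models and related problems*, LNM 1551 (1993), §II
  (14)–(17).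
* R. J. DiPerna, P.-L. Lions, Ann. of Math. 130 (1989) 321–366, §II.
-/

open MeasureTheory Metric Real Set Filter Topology
open scoped InnerProductSpace ENNReal

noncomputable section

namespace Literature.MathematicalPhysics.KineticTheory

open Literature.Analysis.FluidPDE

universe u

section Decay

variable {E : Type*} [NormedAddCommGroup E] [InnerProductSpace ℝ E] [FiniteDimensional ℝ E]
  [MeasurableSpace E] [BorelSpace E]

omit [InnerProductSpace ℝ E] [FiniteDimensional ℝ E] [MeasurableSpace E] [BorelSpace E] in
/-- From the Schwartz-type bounds `|a| ≤ C₀`, `‖z‖^n |a| ≤ Cₙ` to `(1 + ‖z‖)^n |a| ≤ 2^n (C₀ + Cₙ)`.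
[folklore] -/
theorem one_add_norm_pow_mul_abs_le {F : Type*} [NormedAddCommGroup F] (z : F) {n : ℕ} {a C₀ Cₙ : ℝ}
    (h0 : |a| ≤ C₀) (hn : ‖z‖ ^ n * |a| ≤ Cₙ) : (1 + ‖z‖) ^ n * |a| ≤ 2 ^ n * (C₀ + Cₙ) := by
  have hC0 : 0 ≤ C₀ := (abs_nonneg a).trans h0
  have hCn : 0 ≤ Cₙ := le_trans (by positivity) hn
  rcases le_or_gt ‖z‖ 1 with hz | hz
  · have h1 : (1 + ‖z‖) ^ n ≤ 2 ^ n :=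
      pow_le_pow_left₀ (by positivity) (by linarith) n
    calc (1 + ‖z‖) ^ n * |a| ≤ 2 ^ n * C₀ := mul_le_mul h1 h0 (abs_nonneg a) (by positivity)
      _ ≤ 2 ^ n * (C₀ + Cₙ) := by gcongr; linarith
  · have h1 : (1 + ‖z‖) ^ n ≤ 2 ^ n * ‖z‖ ^ n := by
      rw [← mul_pow]; exact pow_le_pow_left₀ (by positivity) (by linarith) n
    calc (1 + ‖z‖) ^ n * |a| ≤ 2 ^ n * ‖z‖ ^ n * |a| :=
          mul_le_mul_of_nonneg_right h1 (abs_nonneg a)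
      _ = 2 ^ n * (‖z‖ ^ n * |a|) := by ring
      _ ≤ 2 ^ n * Cₙ := by gcongr
      _ ≤ 2 ^ n * (C₀ + Cₙ) := by gcongr; linarith

omit [InnerProductSpace ℝ E] [FiniteDimensional ℝ E] [MeasurableSpace E] [BorelSpace E] in
/-- `(1 + ‖x‖)(1 + ‖v‖) ≤ (1 + ‖(x, v)‖)²` for the sup norm on `E × E`. [folklore] -/
theorem one_add_norm_fst_mul_one_add_norm_snd_le (z : E × E) :
    (1 + ‖z.1‖) * (1 + ‖z.2‖) ≤ (1 + ‖z‖) ^ 2 := by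
  have h1 := norm_fst_le z
  have h2 := norm_snd_le z
  nlinarith [norm_nonneg z.1, norm_nonneg z.2]

/-- **Uniform polynomial decay of the approximate solutions**: for every `T` and `P`,
`sup_{s ∈ [0,T]} (1 + ‖x‖)^P (1 + ‖v‖)^P |f(s, x, v)| < ∞` (the Schwartz seminorms of order `0`
of the slices are bounded on compact time intervals). [folklore] -/
theorem IsDiPernaLionsApproximateSolution.uniform_decay {δ : ℝ}
    {B : E × E → sphere (0 : E) 1 → ℝ} {f : ℝ → E → E → ℝ}
    (hf : IsDiPernaLionsApproximateSolution δ B f) (T : ℝ) (hT : 0 ≤ T) (P : ℕ) :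
    ∃ C : ℝ, ∀ s ∈ Icc 0 T, ∀ x v, (1 + ‖x‖) ^ P * (1 + ‖v‖) ^ P * |f s x v| ≤ C := by
  obtain ⟨C₀, hC₀⟩ := hf.decay_slice T hT 0 0
  obtain ⟨C₁, hC₁⟩ := hf.decay_slice T hT (2 * P) 0
  refine ⟨2 ^ (2 * P) * (C₀ + C₁), fun s hs x v => ?_⟩
  have h0 : |f s x v| ≤ C₀ := by
    have := hC₀ s hs (x, v)
    simpa [norm_iteratedFDeriv_zero] using this
  have h1 : ‖(x, v)‖ ^ (2 * P) * |f s x v| ≤ C₁ := by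
    have := hC₁ s hs (x, v)
    simpa [norm_iteratedFDeriv_zero] using this
  have h2 := one_add_norm_pow_mul_abs_le (x, v) h0 h1
  refine le_trans ?_ h2
  rw [pow_mul, ← mul_pow]
  exact mul_le_mul_of_nonneg_right
    (pow_le_pow_left₀ (by positivity) (one_add_norm_fst_mul_one_add_norm_snd_le (x, v)) P)
    (abs_nonneg _)

/-- Decay in the velocity variable alone, with an `x`-dependent constant: for `s ∈ [0, T]`,
`(1 + ‖u‖)^P |f(s, x, u)| ≤ C (1 + ‖x‖)^{-P}`. [folklore] -/
theorem IsDiPernaLionsApproximateSolution.velocity_decay {δ : ℝ}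
    {B : E × E → sphere (0 : E) 1 → ℝ} {f : ℝ → E → E → ℝ}
    (hf : IsDiPernaLionsApproximateSolution δ B f) (T : ℝ) (hT : 0 ≤ T) (P : ℕ) :
    ∃ C : ℝ, 0 ≤ C ∧ ∀ s ∈ Icc 0 T, ∀ x u,
      (1 + ‖u‖) ^ P * |f s x u| ≤ C * (1 + ‖x‖) ^ (-(P : ℝ)) := by
  obtain ⟨C, hC⟩ := hf.uniform_decay T hT P
  have hC0 : 0 ≤ C := le_trans (by positivity) (hC 0 ⟨le_rfl, hT⟩ 0 0)
  refine ⟨C, hC0, fun s hs x u => ?_⟩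
  have h1 : (0 : ℝ) < 1 + ‖x‖ := by positivity
  rw [Real.rpow_neg h1.le, Real.rpow_natCast, ← div_eq_mul_inv, le_div_iff₀ (pow_pos h1 _)]
  calc (1 + ‖u‖) ^ P * |f s x u| * (1 + ‖x‖) ^ P = (1 + ‖x‖) ^ P * (1 + ‖u‖) ^ P * |f s x u| := by
        ring
    _ ≤ C := hC s hs x u

end Decay

/-! ## Pointwise decay and measurability of the normalised collision term -/

section CollisionTerm

variable {E : Type*} [NormedAddCommGroup E] [InnerProductSpace ℝ E] [FiniteDimensional ℝ E]
  [MeasurableSpace E] [BorelSpace E]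

/-- For `δ ≥ 0` the normalising factor `(1 + δ ∫ |g|)⁻¹` lies in `(0, 1]`. [folklore] -/
theorem normalisingFactor_pos_and_le_one {δ : ℝ} (hδ : 0 ≤ δ) (g : E → ℝ) :
    0 < (1 + δ * ∫ w, |g w|)⁻¹ ∧ (1 + δ * ∫ w, |g w|)⁻¹ ≤ 1 := by
  have h0 : 0 ≤ ∫ w, |g w| := integral_nonneg fun w => abs_nonneg _
  have h1 : (1 : ℝ) ≤ 1 + δ * ∫ w, |g w| := le_add_of_nonneg_right (mul_nonneg hδ h0)
  exact ⟨inv_pos.2 (by linarith), inv_le_one_of_one_le₀ h1⟩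

/-- `|Q̃_δ(g, g)(v)| ≤ |Q_B(g, g)(v)|` for `δ ≥ 0`. [folklore] -/
theorem abs_truncatedCollisionOp_le_abs {δ : ℝ} (hδ : 0 ≤ δ) (B : E × E → sphere (0 : E) 1 → ℝ)
    (g : E → ℝ) (v : E) :
    |truncatedCollisionOp δ B g v| ≤ |collisionOpWith B g g v| := by
  obtain ⟨h0, h1⟩ := normalisingFactor_pos_and_le_one hδ g
  rw [truncatedCollisionOp, abs_mul, abs_of_pos h0]
  exact mul_le_of_le_one_left (abs_nonneg _) h1

omit [InnerProductSpace ℝ E] [FiniteDimensional ℝ E] [MeasurableSpace E] [BorelSpace E] in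
/-- `(1 + ‖u‖)^{-r} ≤ 1`. [folklore] -/
theorem rpow_neg_one_add_norm_le_one (u : E) {r : ℝ} (hr : 0 ≤ r) : (1 + ‖u‖) ^ (-r) ≤ 1 :=
  Real.rpow_le_one_of_one_le_of_nonpos (by linarith [norm_nonneg u]) (by linarith)

omit [InnerProductSpace ℝ E] [FiniteDimensional ℝ E] [MeasurableSpace E] [BorelSpace E] in
/-- Monotonicity of `(1 + ‖u‖)^{-r}` in the exponent. [folklore] -/
theorem rpow_neg_one_add_norm_anti (u : E) {a b : ℝ} (hab : a ≤ b) :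
    (1 + ‖u‖) ^ (-b) ≤ (1 + ‖u‖) ^ (-a) :=
  Real.rpow_le_rpow_of_exponent_le (by linarith [norm_nonneg u]) (by linarith)

/-- **Pointwise decay of the normalised collision term of an approximate solution**, uniformly on
compact time intervals: for a kernel of polynomial growth `0 ≤ B ≤ C_B (1 + ‖v - v_*‖)^k`, `δ ≥ 0`,
and all decay orders `a, b`,
`sup_{s ∈ [0,T]} (1 + ‖x‖)^a (1 + ‖v‖)^b |Q̃_δ(f, f)(s, x, v)| < ∞`
(Schwartz decay of the slices and `exists_abs_collisionOpWith_le_of_decay`). [folklore] -/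
theorem IsDiPernaLionsApproximateSolution.exists_abs_truncatedCollisionOp_le {δ : ℝ}
    {B : E × E → sphere (0 : E) 1 → ℝ} {f : ℝ → E → E → ℝ}
    (hf : IsDiPernaLionsApproximateSolution δ B f) (hδ : 0 ≤ δ) (hB0 : ∀ p ω, 0 ≤ B p ω)
    (hpoly : ∃ C : ℝ, ∃ k : ℕ, ∀ p ω, B p ω ≤ C * (1 + ‖p.1 - p.2‖) ^ k) (T : ℝ) (hT : 0 ≤ T)
    (a b : ℕ) :
    ∃ C : ℝ, 0 ≤ C ∧ ∀ s ∈ Icc 0 T, ∀ x v, |truncatedCollisionOp δ B (f s x) v| ≤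
      C * ((1 + ‖x‖) ^ (-(a : ℝ)) * (1 + ‖v‖) ^ (-(b : ℝ))) := by
  obtain ⟨C_B, k, hBle⟩ := hpoly
  set M : ℕ := Module.finrank ℝ E + k + b + 1 with hM
  obtain ⟨C₁, hC₁0, hC₁⟩ := exists_abs_collisionOpWith_le_of_decay hB0 hBle (M := M) (by omega)
  set P : ℕ := 2 * M + a with hP
  obtain ⟨C₂, hC₂0, hC₂⟩ := hf.velocity_decay T hT P
  refine ⟨C₁ * C₂ ^ 2, by positivity, fun s hs x v => ?_⟩
  have hx1 : (1 : ℝ) ≤ 1 + ‖x‖ := by linarith [norm_nonneg x]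
  -- decay of the velocity density `f(s, x, ·)` at order `2M`, constant `C₂ (1+‖x‖)^(-P)`
  have hg : ∀ u, (1 + ‖u‖) ^ (2 * M) * |f s x u| ≤ C₂ * (1 + ‖x‖) ^ (-(P : ℝ)) := by
    intro u
    refine le_trans ?_ (hC₂ s hs x u)
    exact mul_le_mul_of_nonneg_right
      (pow_le_pow_right₀ (by linarith [norm_nonneg u]) (by omega)) (abs_nonneg _)
  have hQ := hC₁ (f s x) _ hg v
  refine (abs_truncatedCollisionOp_le_abs hδ B (f s x) v).trans (hQ.trans ?_)
  -- compare the weights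
  have hw : (1 + ‖x‖) ^ (-(P : ℝ)) ≤ 1 := rpow_neg_one_add_norm_le_one x (by positivity)
  have hw0 : 0 ≤ (1 + ‖x‖) ^ (-(P : ℝ)) := Real.rpow_nonneg (by positivity) _
  have hxa : ((1 + ‖x‖) ^ (-(P : ℝ))) ^ 2 ≤ (1 + ‖x‖) ^ (-(a : ℝ)) := by
    calc ((1 + ‖x‖) ^ (-(P : ℝ))) ^ 2 ≤ (1 + ‖x‖) ^ (-(P : ℝ)) := by
          rw [sq]; exact mul_le_of_le_one_left hw0 hw
      _ ≤ (1 + ‖x‖) ^ (-(a : ℝ)) :=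
          rpow_neg_one_add_norm_anti x (by rw [hP]; exact_mod_cast Nat.le_add_left a (2 * M))
  have hvb : (1 + ‖v‖) ^ (-((M - k : ℕ) : ℝ)) ≤ (1 + ‖v‖) ^ (-(b : ℝ)) :=
    rpow_neg_one_add_norm_anti v (by exact_mod_cast (by omega : b ≤ M - k))
  calc C₁ * (C₂ * (1 + ‖x‖) ^ (-(P : ℝ))) ^ 2 * (1 + ‖v‖) ^ (-((M - k : ℕ) : ℝ))
      = C₁ * C₂ ^ 2 * (((1 + ‖x‖) ^ (-(P : ℝ))) ^ 2 * (1 + ‖v‖) ^ (-((M - k : ℕ) : ℝ))) := by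
        ring
    _ ≤ C₁ * C₂ ^ 2 * ((1 + ‖x‖) ^ (-(a : ℝ)) * (1 + ‖v‖) ^ (-(b : ℝ))) := by
        refine mul_le_mul_of_nonneg_left ?_ (by positivity)
        exact mul_le_mul hxa hvb (Real.rpow_nonneg (by positivity) _)
          (Real.rpow_nonneg (by positivity) _)

/-- **Joint measurability of the normalised collision term** of an approximate solution, composed
with the time clamp `s ↦ max s 0` (under which it is unchanged for `s ≥ 0`). [folklore] -/
theorem IsDiPernaLionsApproximateSolution.measurable_truncatedCollisionOp_clamp {δ : ℝ}
    {B : E × E → sphere (0 : E) 1 → ℝ} {f : ℝ → E → E → ℝ}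
    (hf : IsDiPernaLionsApproximateSolution δ B f) (hBm : Measurable (Function.uncurry B)) :
    Measurable fun q : ℝ × E × E => truncatedCollisionOp δ B (f (max q.1 0) q.2.1) q.2.2 := by
  have hI : Measurable fun p : ℝ × E => ∫ w, |f (max p.1 0) p.2 w| := by
    have hc : Continuous fun y : (ℝ × E) × E => |f (max y.1.1 0) y.1.2 y.2| :=
      continuous_abs.comp (hf.continuous_clamp (continuous_fst.comp continuous_fst)
        (continuous_snd.comp continuous_fst) continuous_snd)
    exact (hc.stronglyMeasurable.integral_prod_right' (ν := (volume : Measure E))).measurable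
  have ha : Measurable fun q : ℝ × E × E => (1 + δ * ∫ w, |f (max q.1 0) q.2.1 w|)⁻¹ :=
    (measurable_const.add (measurable_const.mul
      (hI.comp (measurable_fst.prodMk measurable_snd.fst)))).inv
  have hg : Measurable (Function.uncurry fun (q : ℝ × E × E) (w : E) => f (max q.1 0) q.2.1 w) :=
    (hf.continuous_clamp (continuous_fst.comp continuous_fst)
      (continuous_fst.comp (continuous_snd.comp continuous_fst)) continuous_snd).measurable
  have hQ := measurable_collisionOpWith_param (B := B) hBm hg measurable_snd.snd
  exact ha.mul hQ

end CollisionTerm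

/-! ## Phase space-time: restricted measures and the free-flow shear -/

section SpaceTime

variable {E : Type*} [NormedAddCommGroup E] [InnerProductSpace ℝ E] [FiniteDimensional ℝ E]
  [MeasurableSpace E] [BorelSpace E]

/-- Lebesgue measure on the slab `(0, T] × E × E` is the product of Lebesgue measure on `(0, T]`
and of `volume.prod volume` on `E × E`. [folklore] -/
theorem volume_restrict_Ioc_prod_univ (T : ℝ) :
    (volume : Measure (ℝ × E × E)).restrict (Ioc 0 T ×ˢ univ) =
      ((volume : Measure ℝ).restrict (Ioc 0 T)).prod ((volume : Measure E).prod volume) := by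
  rw [← Measure.restrict_univ (μ := ((volume : Measure E).prod volume)), Measure.prod_restrict]
  rfl

/-- Almost every point of the slab measure has its time coordinate in `(0, T]`. [folklore] -/
theorem ae_fst_mem_Ioc (T : ℝ) :
    ∀ᵐ q : ℝ × E × E ∂((volume : Measure ℝ).restrict (Ioc 0 T)).prod
      ((volume : Measure E).prod volume), q.1 ∈ Ioc 0 T := by
  rw [← volume_restrict_Ioc_prod_univ]
  filter_upwards [ae_restrict_mem (measurableSet_Ioc.prod MeasurableSet.univ)] with q hq
  exact hq.1

/-- `shearFlow` preserves Lebesgue measure restricted to the slab `(0, T] × E × E`. [folklore] -/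
theorem measurePreserving_shearFlow_restrict_Ioc (T : ℝ) :
    MeasurePreserving (shearFlow (E := E)) (volume.restrict (Ioc 0 T ×ˢ univ))
      (volume.restrict (Ioc 0 T ×ˢ univ)) := by
  have h := (measurePreserving_shearFlow (E := E)).restrict_preimage
    (s := Ioc (0 : ℝ) T ×ˢ (univ : Set (E × E)))
    (measurableSet_Ioc.prod (MeasurableSet.univ (α := E × E)))
  have hpre : shearFlow ⁻¹' (Ioc (0 : ℝ) T ×ˢ (univ : Set (E × E))) = Ioc 0 T ×ˢ univ := by
    ext q; simp
  rwa [hpre] at h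

/-- Integrability on the slab is invariant under the free-flow shear `(s, x, v) ↦ (s, x + s v, v)`.
[folklore] -/
theorem integrable_comp_shearFlow_iff (T : ℝ) (H : ℝ × E × E → ℝ) :
    Integrable (fun q : ℝ × E × E => H (q.1, q.2.1 + q.1 • q.2.2, q.2.2))
        (((volume : Measure ℝ).restrict (Ioc 0 T)).prod ((volume : Measure E).prod volume)) ↔
      Integrable H (((volume : Measure ℝ).restrict (Ioc 0 T)).prod
        ((volume : Measure E).prod volume)) := by
  rw [← volume_restrict_Ioc_prod_univ]
  exact (measurePreserving_shearFlow_restrict_Ioc (E := E) T).integrable_comp_emb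
    measurableEmbedding_shearFlow (g := H)

end SpaceTime

/-! ## Integration along characteristics: the generic identity -/

section Engine

variable {E : Type*} [NormedAddCommGroup E] [InnerProductSpace ℝ E] [FiniteDimensional ℝ E]
  [MeasurableSpace E] [BorelSpace E]

omit [InnerProductSpace ℝ E] [FiniteDimensional ℝ E] [MeasurableSpace E] [BorelSpace E] in
/-- Bookkeeping of weights: `(1 + ‖u‖)^m (1 + ‖u‖)^{-(m + r)} = (1 + ‖u‖)^{-r}`. [folklore] -/
theorem one_add_norm_pow_mul_rpow_neg (u : E) (m r : ℕ) :
    (1 + ‖u‖) ^ m * (1 + ‖u‖) ^ (-((m + r : ℕ) : ℝ)) = (1 + ‖u‖) ^ (-(r : ℝ)) := by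
  have h1 : (0 : ℝ) < 1 + ‖u‖ := by positivity
  rw [← Real.rpow_natCast, ← Real.rpow_add h1]
  congr 1
  push_cast
  ring

/-- **Domination of the weighted normalised collision term** of an approximate solution on
`[0, T]`: for a measurable weight of polynomial growth
`|W(s, x, v)| ≤ C_W (1 + ‖x‖)^m (1 + ‖v‖)^m`,
`|W Q̃_δ(f,f)| ≤ C (1 + ‖x‖)^{-(d+1)} (1 + ‖v‖)^{-(d+1)}` with `d = dim E`. [folklore] -/
theorem IsDiPernaLionsApproximateSolution.exists_weight_mul_truncatedCollisionOp_le {δ : ℝ}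
    {B : E × E → sphere (0 : E) 1 → ℝ} {f : ℝ → E → E → ℝ}
    (hf : IsDiPernaLionsApproximateSolution δ B f) (hδ : 0 ≤ δ) (hB0 : ∀ p ω, 0 ≤ B p ω)
    (hpoly : ∃ C : ℝ, ∃ k : ℕ, ∀ p ω, B p ω ≤ C * (1 + ‖p.1 - p.2‖) ^ k) {T : ℝ} (hT : 0 ≤ T)
    {W : ℝ → E → E → ℝ} {C_W : ℝ} {m : ℕ}
    (hWle : ∀ s ∈ Icc 0 T, ∀ x v, |W s x v| ≤ C_W * (1 + ‖x‖) ^ m * (1 + ‖v‖) ^ m) :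
    ∃ C : ℝ, 0 ≤ C ∧ ∀ s ∈ Icc 0 T, ∀ x v,
      |W s x v * truncatedCollisionOp δ B (f s x) v| ≤
        C * ((1 + ‖x‖) ^ (-((Module.finrank ℝ E + 1 : ℕ) : ℝ)) *
          (1 + ‖v‖) ^ (-((Module.finrank ℝ E + 1 : ℕ) : ℝ))) := by
  set r : ℕ := Module.finrank ℝ E + 1 with hr
  obtain ⟨C, hC0, hC⟩ := hf.exists_abs_truncatedCollisionOp_le hδ hB0 hpoly T hT (m + r) (m + r)
  refine ⟨|C_W| * C, by positivity, fun s hs x v => ?_⟩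
  rw [abs_mul]
  have h1 := (hWle s hs x v).trans
    (mul_le_mul_of_nonneg_right (mul_le_mul_of_nonneg_right (le_abs_self C_W) (by positivity))
      (by positivity))
  calc |W s x v| * |truncatedCollisionOp δ B (f s x) v|
      ≤ (|C_W| * (1 + ‖x‖) ^ m * (1 + ‖v‖) ^ m) *
          (C * ((1 + ‖x‖) ^ (-((m + r : ℕ) : ℝ)) * (1 + ‖v‖) ^ (-((m + r : ℕ) : ℝ)))) :=
        mul_le_mul h1 (hC s hs x v) (abs_nonneg _) (by positivity)
    _ = |C_W| * C * (((1 + ‖x‖) ^ m * (1 + ‖x‖) ^ (-((m + r : ℕ) : ℝ))) *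
          ((1 + ‖v‖) ^ m * (1 + ‖v‖) ^ (-((m + r : ℕ) : ℝ)))) := by ring
    _ = |C_W| * C * ((1 + ‖x‖) ^ (-(r : ℝ)) * (1 + ‖v‖) ^ (-(r : ℝ))) := by
        rw [one_add_norm_pow_mul_rpow_neg, one_add_norm_pow_mul_rpow_neg]

/-- The weighted normalised collision term of an approximate solution is integrable on every
slice `s ∈ [0, T]`. [folklore] -/
theorem IsDiPernaLionsApproximateSolution.integrable_weight_mul_truncatedCollisionOp_slice
    {δ : ℝ} {B : E × E → sphere (0 : E) 1 → ℝ} {f : ℝ → E → E → ℝ}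
    (hf : IsDiPernaLionsApproximateSolution δ B f) (hδ : 0 ≤ δ)
    (hBm : Measurable (Function.uncurry B)) (hB0 : ∀ p ω, 0 ≤ B p ω)
    (hpoly : ∃ C : ℝ, ∃ k : ℕ, ∀ p ω, B p ω ≤ C * (1 + ‖p.1 - p.2‖) ^ k) {T : ℝ} (hT : 0 ≤ T)
    {W : ℝ → E → E → ℝ} (hWm : Measurable fun q : ℝ × E × E => W q.1 q.2.1 q.2.2)
    {C_W : ℝ} {m : ℕ}
    (hWle : ∀ s ∈ Icc 0 T, ∀ x v, |W s x v| ≤ C_W * (1 + ‖x‖) ^ m * (1 + ‖v‖) ^ m)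
    {s : ℝ} (hs : s ∈ Icc 0 T) :
    Integrable (fun z : E × E => W s z.1 z.2 * truncatedCollisionOp δ B (f s z.1) z.2)
      ((volume : Measure E).prod volume) := by
  obtain ⟨C, hC0, hC⟩ := hf.exists_weight_mul_truncatedCollisionOp_le hδ hB0 hpoly hT hWle
  set r : ℕ := Module.finrank ℝ E + 1 with hr
  have hrE : (Module.finrank ℝ E : ℝ) < (r : ℝ) := by rw [hr]; exact_mod_cast Nat.lt_succ_self _
  set ρ : E → ℝ := fun u => (1 + ‖u‖) ^ (-(r : ℝ)) with hρ
  have hρi : Integrable ρ (volume : Measure E) := integrable_one_add_norm hrE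
  have hdom : Integrable (fun z : E × E => C * (ρ z.1 * ρ z.2)) ((volume : Measure E).prod volume) :=
    (hρi.mul_prod hρi).const_mul C
  -- measurability through the time clamp
  have hHm : Measurable fun q : ℝ × E × E =>
      W q.1 q.2.1 q.2.2 * truncatedCollisionOp δ B (f (max q.1 0) q.2.1) q.2.2 :=
    hWm.mul (hf.measurable_truncatedCollisionOp_clamp hBm)
  have hsm : Measurable fun z : E × E => W s z.1 z.2 * truncatedCollisionOp δ B (f s z.1) z.2 := by
    have h := hHm.comp (measurable_const.prodMk measurable_id : Measurable fun z : E × E => (s, z))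
    have hs0 : max s 0 = s := max_eq_left hs.1
    simpa only [Function.comp_def, hs0] using h
  refine hdom.mono' hsm.aestronglyMeasurable (Eventually.of_forall fun z => ?_)
  rw [Real.norm_eq_abs]
  exact hC s hs z.1 z.2

/-- The weighted normalised collision term of an approximate solution is integrable on the slab
`(0, T] × E × E`. [folklore] -/
theorem IsDiPernaLionsApproximateSolution.integrable_weight_mul_truncatedCollisionOp
    {δ : ℝ} {B : E × E → sphere (0 : E) 1 → ℝ} {f : ℝ → E → E → ℝ}
    (hf : IsDiPernaLionsApproximateSolution δ B f) (hδ : 0 ≤ δ)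
    (hBm : Measurable (Function.uncurry B)) (hB0 : ∀ p ω, 0 ≤ B p ω)
    (hpoly : ∃ C : ℝ, ∃ k : ℕ, ∀ p ω, B p ω ≤ C * (1 + ‖p.1 - p.2‖) ^ k) {T : ℝ} (hT : 0 ≤ T)
    {W : ℝ → E → E → ℝ} (hWm : Measurable fun q : ℝ × E × E => W q.1 q.2.1 q.2.2)
    {C_W : ℝ} {m : ℕ}
    (hWle : ∀ s ∈ Icc 0 T, ∀ x v, |W s x v| ≤ C_W * (1 + ‖x‖) ^ m * (1 + ‖v‖) ^ m) :
    Integrable (fun q : ℝ × E × E => W q.1 q.2.1 q.2.2 * truncatedCollisionOp δ B (f q.1 q.2.1) q.2.2)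
      (((volume : Measure ℝ).restrict (Ioc 0 T)).prod ((volume : Measure E).prod volume)) := by
  obtain ⟨C, hC0, hC⟩ := hf.exists_weight_mul_truncatedCollisionOp_le hδ hB0 hpoly hT hWle
  set r : ℕ := Module.finrank ℝ E + 1 with hr
  have hrE : (Module.finrank ℝ E : ℝ) < (r : ℝ) := by rw [hr]; exact_mod_cast Nat.lt_succ_self _
  set ρ : E → ℝ := fun u => (1 + ‖u‖) ^ (-(r : ℝ)) with hρ
  have hρi : Integrable ρ (volume : Measure E) := integrable_one_add_norm hrE
  haveI : IsFiniteMeasure ((volume : Measure ℝ).restrict (Ioc 0 T)) :=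
    ⟨by rw [Measure.restrict_apply_univ]; exact measure_Ioc_lt_top⟩
  have hdom : Integrable (fun q : ℝ × E × E => C * (ρ q.2.1 * ρ q.2.2))
      (((volume : Measure ℝ).restrict (Ioc 0 T)).prod ((volume : Measure E).prod volume)) :=
    ((hρi.mul_prod hρi).const_mul C).comp_snd _
  -- the clamped version is measurable and agrees a.e.
  have hHm : Measurable fun q : ℝ × E × E =>
      W q.1 q.2.1 q.2.2 * truncatedCollisionOp δ B (f (max q.1 0) q.2.1) q.2.2 :=
    hWm.mul (hf.measurable_truncatedCollisionOp_clamp hBm)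
  have hHi : Integrable (fun q : ℝ × E × E =>
      W q.1 q.2.1 q.2.2 * truncatedCollisionOp δ B (f (max q.1 0) q.2.1) q.2.2)
      (((volume : Measure ℝ).restrict (Ioc 0 T)).prod ((volume : Measure E).prod volume)) := by
    refine hdom.mono' hHm.aestronglyMeasurable ?_
    filter_upwards [ae_fst_mem_Ioc (E := E) T] with q hq
    rw [Real.norm_eq_abs, max_eq_left hq.1.le]
    exact hC q.1 ⟨hq.1.le, hq.2⟩ q.2.1 q.2.2
  refine hHi.congr ?_
  filter_upwards [ae_fst_mem_Ioc (E := E) T] with q hq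
  rw [max_eq_left hq.1.le]

/-- **Integration along characteristics** (the mechanism behind CIP 1994 Lemma 5.3.1: instead of
differentiating `∫∫ f ψ` under the integral sign, integrate the truncated equation along each
characteristic and exchange the integrals). Let `f` be an approximate solution, `δ ≥ 0`, `B ≥ 0`
measurable of polynomial growth, `W` a measurable weight of polynomial growth on `[0, T]`, and
`Φ(·, z)` continuous on `[0, T]` with
`d/ds Φ(s, x, v) = W(s, x + s v, v) Q̃_δ(f,f)(s, x + s v, v)` on `(0, T)` and `Φ(T), Φ(0) ∈ L¹`.
Then `∫ Φ(T) - ∫ Φ(0) = ∫₀ᵀ ∫∫ W(s, x, v) Q̃_δ(f,f)(s, x, v) dx dv ds` (fundamental theorem of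
calculus on each characteristic, Fubini on `(0,T] × E × E`, and the measure-preserving shear
`(x, v) ↦ (x + s v, v)` on each slice). [cite: CIPDiluteGases1994, §5.3 Lemma 5.3.1 (proof, p. 142)] -/
theorem IsDiPernaLionsApproximateSolution.integral_sub_integral_eq_integral_collision
    {δ : ℝ} {B : E × E → sphere (0 : E) 1 → ℝ} {f : ℝ → E → E → ℝ}
    (hf : IsDiPernaLionsApproximateSolution δ B f) (hδ : 0 ≤ δ)
    (hBm : Measurable (Function.uncurry B)) (hB0 : ∀ p ω, 0 ≤ B p ω)
    (hpoly : ∃ C : ℝ, ∃ k : ℕ, ∀ p ω, B p ω ≤ C * (1 + ‖p.1 - p.2‖) ^ k) {T : ℝ} (hT : 0 ≤ T)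
    {W : ℝ → E → E → ℝ} (hWm : Measurable fun q : ℝ × E × E => W q.1 q.2.1 q.2.2)
    {C_W : ℝ} {m : ℕ}
    (hWle : ∀ s ∈ Icc 0 T, ∀ x v, |W s x v| ≤ C_W * (1 + ‖x‖) ^ m * (1 + ‖v‖) ^ m)
    {Φ : ℝ → E × E → ℝ} (hΦc : ∀ z, ContinuousOn (fun s => Φ s z) (Icc 0 T))
    (hΦd : ∀ z : E × E, ∀ s ∈ Ioo 0 T, HasDerivAt (fun σ => Φ σ z)
      (W s (z.1 + s • z.2) z.2 * truncatedCollisionOp δ B (f s (z.1 + s • z.2)) z.2) s)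
    (hΦT : Integrable (Φ T) ((volume : Measure E).prod volume))
    (hΦ0 : Integrable (Φ 0) ((volume : Measure E).prod volume)) :
    (∫ z, Φ T z ∂((volume : Measure E).prod volume)) - ∫ z, Φ 0 z ∂((volume : Measure E).prod volume) =
      ∫ s in Ioc 0 T, ∫ z, W s z.1 z.2 * truncatedCollisionOp δ B (f s z.1) z.2
        ∂((volume : Measure E).prod volume) := by
  -- the integrand in the un-sheared and sheared pictures
  set H : ℝ × E × E → ℝ := fun q =>
    W q.1 q.2.1 q.2.2 * truncatedCollisionOp δ B (f q.1 q.2.1) q.2.2 with hH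
  set G : ℝ → E × E → ℝ := fun s z =>
    W s (z.1 + s • z.2) z.2 * truncatedCollisionOp δ B (f s (z.1 + s • z.2)) z.2 with hG
  have hHi : Integrable H (((volume : Measure ℝ).restrict (Ioc 0 T)).prod
      ((volume : Measure E).prod volume)) :=
    hf.integrable_weight_mul_truncatedCollisionOp hδ hBm hB0 hpoly hT hWm hWle
  have hGi : Integrable (fun q : ℝ × E × E => G q.1 q.2)
      (((volume : Measure ℝ).restrict (Ioc 0 T)).prod ((volume : Measure E).prod volume)) :=
    (integrable_comp_shearFlow_iff T H).2 hHi
  -- uniform bound and measurability of the clamped sheared integrand (for the pointwise FTC)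
  obtain ⟨C, hC0, hC⟩ := hf.exists_weight_mul_truncatedCollisionOp_le hδ hB0 hpoly hT hWle
  have hHcm : Measurable fun q : ℝ × E × E =>
      W q.1 q.2.1 q.2.2 * truncatedCollisionOp δ B (f (max q.1 0) q.2.1) q.2.2 :=
    hWm.mul (hf.measurable_truncatedCollisionOp_clamp hBm)
  have hFTC : ∀ z : E × E, Φ T z - Φ 0 z = ∫ s in Ioc 0 T, G s z := by
    intro z
    -- interval integrability of `G(·, z)` on `[0, T]`: bounded and measurable on `(0, T]`
    have hGcm : Measurable fun s : ℝ =>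
        W s (z.1 + s • z.2) z.2 * truncatedCollisionOp δ B (f (max s 0) (z.1 + s • z.2)) z.2 := by
      have hγ : Measurable fun s : ℝ => ((s, z.1 + s • z.2, z.2) : ℝ × E × E) := by
        exact (by fun_prop : Continuous fun s : ℝ => ((s, z.1 + s • z.2, z.2) : ℝ × E × E)).measurable
      exact hHcm.comp hγ
    have hGon : IntegrableOn (fun s => G s z) (Ioc 0 T) := by
      have h1 : IntegrableOn (fun s : ℝ =>
          W s (z.1 + s • z.2) z.2 * truncatedCollisionOp δ B (f (max s 0) (z.1 + s • z.2)) z.2)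
          (Ioc 0 T) := by
        refine Measure.integrableOn_of_bounded (M := C) measure_Ioc_lt_top.ne
          hGcm.aestronglyMeasurable ?_
        filter_upwards [ae_restrict_mem measurableSet_Ioc] with s hs
        rw [Real.norm_eq_abs, max_eq_left hs.1.le]
        refine (hC s ⟨hs.1.le, hs.2⟩ (z.1 + s • z.2) z.2).trans ?_
        refine mul_le_of_le_one_right hC0 ?_
        exact mul_le_one₀ (rpow_neg_one_add_norm_le_one _ (by positivity))
          (Real.rpow_nonneg (by positivity) _) (rpow_neg_one_add_norm_le_one _ (by positivity))
      refine h1.congr_fun (fun s hs => ?_) measurableSet_Ioc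
      simp only [hG, max_eq_left hs.1.le]
    have hint : IntervalIntegrable (fun s => G s z) volume 0 T :=
      (intervalIntegrable_iff_integrableOn_Ioc_of_le hT).2 hGon
    have h := intervalIntegral.integral_eq_sub_of_hasDerivAt_of_le hT (hΦc z) (hΦd z) hint
    rw [intervalIntegral.integral_of_le hT] at h
    exact h.symm
  -- integrate over phase space and exchange the integrals
  calc (∫ z, Φ T z ∂((volume : Measure E).prod volume)) - ∫ z, Φ 0 z ∂((volume : Measure E).prod volume)
      = ∫ z, (Φ T z - Φ 0 z) ∂((volume : Measure E).prod volume) := (integral_sub hΦT hΦ0).symm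
    _ = ∫ z, (∫ s in Ioc 0 T, G s z) ∂((volume : Measure E).prod volume) :=
        integral_congr_ae (Eventually.of_forall hFTC)
    _ = ∫ s in Ioc 0 T, ∫ z, G s z ∂((volume : Measure E).prod volume) := by
        have hsw : Integrable (Function.uncurry fun (z : E × E) (s : ℝ) => G s z)
            (((volume : Measure E).prod volume).prod ((volume : Measure ℝ).restrict (Ioc 0 T))) :=
          hGi.swap
        exact integral_integral_swap hsw
    _ = ∫ s in Ioc 0 T, ∫ z, W s z.1 z.2 * truncatedCollisionOp δ B (f s z.1) z.2
          ∂((volume : Measure E).prod volume) := by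
        refine setIntegral_congr_fun measurableSet_Ioc fun s _ => ?_
        exact (measurePreserving_freeShearEquiv s).integral_comp'
          (fun y : E × E => W s y.1 y.2 * truncatedCollisionOp δ B (f s y.1) y.2)

end Engine

/-! ## Conservation laws (CIP 1994 Lemma 5.3.1, (3.4)–(3.6)) -/

section Conservation

variable {E : Type*} [NormedAddCommGroup E] [InnerProductSpace ℝ E] [FiniteDimensional ℝ E]
  [MeasurableSpace E] [BorelSpace E]

/-- A slice `f(s)`, `s ∈ [0, T]`, times a measurable weight of polynomial growth is integrable on
phase space. [folklore] -/
theorem IsDiPernaLionsApproximateSolution.integrable_slice_mul_weight {δ : ℝ}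
    {B : E × E → sphere (0 : E) 1 → ℝ} {f : ℝ → E → E → ℝ}
    (hf : IsDiPernaLionsApproximateSolution δ B f) {T : ℝ} (hT : 0 ≤ T) {s : ℝ} (hs : s ∈ Icc 0 T)
    {w : E × E → ℝ} (hwm : Measurable w) {C_w : ℝ} {m : ℕ}
    (hw : ∀ z, |w z| ≤ C_w * (1 + ‖z.1‖) ^ m * (1 + ‖z.2‖) ^ m) :
    Integrable (fun z : E × E => f s z.1 z.2 * w z) ((volume : Measure E).prod volume) := by
  set r : ℕ := Module.finrank ℝ E + 1 with hr
  have hrE : (Module.finrank ℝ E : ℝ) < (r : ℝ) := by rw [hr]; exact_mod_cast Nat.lt_succ_self _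
  obtain ⟨C, hC⟩ := hf.uniform_decay T hT (m + r)
  have hC0 : 0 ≤ C := le_trans (by positivity) (hC s hs 0 0)
  set ρ : E → ℝ := fun u => (1 + ‖u‖) ^ (-(r : ℝ)) with hρ
  have hρi : Integrable ρ (volume : Measure E) := integrable_one_add_norm hrE
  have hdom : Integrable (fun z : E × E => |C_w| * C * (ρ z.1 * ρ z.2))
      ((volume : Measure E).prod volume) := (hρi.mul_prod hρi).const_mul _
  have hfm : Measurable fun z : E × E => f s z.1 z.2 :=
    (hf.contDiff_slice s hs.1).continuous.measurable
  refine hdom.mono' (hfm.mul hwm).aestronglyMeasurable (Eventually.of_forall fun z => ?_)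
  rw [Real.norm_eq_abs, abs_mul]
  -- `|f| |w| ≤ |C_w| (1+|x|)^m (1+|v|)^m |f| ≤ |C_w| C ρ(x) ρ(v)`
  have hx : (0 : ℝ) < 1 + ‖z.1‖ := by positivity
  have hv : (0 : ℝ) < 1 + ‖z.2‖ := by positivity
  have hdec := hC s hs z.1 z.2
  have hw' : |w z| ≤ |C_w| * (1 + ‖z.1‖) ^ m * (1 + ‖z.2‖) ^ m :=
    (hw z).trans (mul_le_mul_of_nonneg_right
      (mul_le_mul_of_nonneg_right (le_abs_self _) (by positivity)) (by positivity))
  -- express the decay through `ρ`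
  have hρx : (1 + ‖z.1‖) ^ (m + r) * ρ z.1 = (1 + ‖z.1‖) ^ m := by
    rw [hρ]; dsimp only
    rw [pow_add, mul_assoc, ← Real.rpow_natCast _ r, ← Real.rpow_add hx, add_neg_cancel,
      Real.rpow_zero, mul_one]
  have hρv : (1 + ‖z.2‖) ^ (m + r) * ρ z.2 = (1 + ‖z.2‖) ^ m := by
    rw [hρ]; dsimp only
    rw [pow_add, mul_assoc, ← Real.rpow_natCast _ r, ← Real.rpow_add hv, add_neg_cancel,
      Real.rpow_zero, mul_one]
  have hρx0 : 0 < ρ z.1 := Real.rpow_pos_of_pos hx _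
  have hρv0 : 0 < ρ z.2 := Real.rpow_pos_of_pos hv _
  calc |f s z.1 z.2| * |w z| ≤ |f s z.1 z.2| * (|C_w| * (1 + ‖z.1‖) ^ m * (1 + ‖z.2‖) ^ m) :=
        mul_le_mul_of_nonneg_left hw' (abs_nonneg _)
    _ = |C_w| * ((1 + ‖z.1‖) ^ (m + r) * (1 + ‖z.2‖) ^ (m + r) * |f s z.1 z.2|) *
          (ρ z.1 * ρ z.2) := by rw [← hρx, ← hρv]; ring
    _ ≤ |C_w| * C * (ρ z.1 * ρ z.2) :=
        mul_le_mul_of_nonneg_right (mul_le_mul_of_nonneg_left hdec (abs_nonneg _)) (by positivity)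

/-- **Conservation law for transport-invariant collision-invariant weights** (CIP 1994 §5.3,
proof of Lemma 5.3.1, p. 142: "if `Tψ = 0` and `ψ(t, x, ·)` is a collision invariant for each
`(t, x)`, then `d/dt ∫∫ f ψ dx dξ = 0`"). Let `f` be an approximate solution of the truncated
equation with `δ ≥ 0` and a DiPerna–Lions kernel of polynomial growth, and let `Ψ(s, x, v)` be a
measurable weight of polynomial growth on compact time intervals which is invariant under free
transport, `Ψ(s, x + s v, v) = Ψ(0, x, v)`, and a collision invariant in `v` for each `(s, x)`.
Then `∫∫ f(T) Ψ(T) dx dv = ∫∫ f(0) Ψ(0) dx dv` for every `T ≥ 0`. Proof: integrate the equation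
along characteristics (`integral_sub_integral_eq_integral_collision` with
`Φ(s, x, v) = Ψ(0, x, v) f(s, x + s v, v)`); on each slice the collision contribution
`∫ Q̃_δ(f,f)(s, x, ·) Ψ(s, x, ·) dv` vanishes by the weak formulation
(`integral_collisionOpWith_mul_eq_zero`). [cite: CIPDiluteGases1994, §5.3 Lemma 5.3.1 (proof, p. 142)] -/
theorem IsDiPernaLionsApproximateSolution.integral_mul_eq_of_transport_collision_invariant
    {δ : ℝ} {B : E × E → sphere (0 : E) 1 → ℝ} {f : ℝ → E → E → ℝ}
    (hf : IsDiPernaLionsApproximateSolution δ B f) (hδ : 0 ≤ δ)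
    (hBk : KineticTheory.IsDiPernaLionsKernel B)
    (hpoly : ∃ C : ℝ, ∃ k : ℕ, ∀ p ω, B p ω ≤ C * (1 + ‖p.1 - p.2‖) ^ k)
    {Ψ : ℝ → E → E → ℝ} (hΨm : Measurable fun q : ℝ × E × E => Ψ q.1 q.2.1 q.2.2)
    (hΨT : ∀ s x v, Ψ s (x + s • v) v = Ψ 0 x v)
    (hΨci : ∀ s x, IsCollisionInvariant (Ψ s x))
    (hΨle : ∀ T ≥ (0 : ℝ), ∃ C_W : ℝ, ∃ m : ℕ, ∀ s ∈ Icc 0 T, ∀ x v,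
      |Ψ s x v| ≤ C_W * (1 + ‖x‖) ^ m * (1 + ‖v‖) ^ m)
    (T : ℝ) (hT : 0 ≤ T) :
    ∫ z, f T z.1 z.2 * Ψ T z.1 z.2 ∂((volume : Measure E).prod volume) =
      ∫ z, f 0 z.1 z.2 * Ψ 0 z.1 z.2 ∂((volume : Measure E).prod volume) := by
  obtain ⟨C_W, m, hWle⟩ := hΨle T hT
  have hBm := hBk.measurable
  have hB0 := hBk.nonneg
  -- measurability of the sections of `Ψ`
  have hΨsm : ∀ s, Measurable fun z : E × E => Ψ s z.1 z.2 := fun s =>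
    hΨm.comp (measurable_const.prodMk measurable_id : Measurable fun z : E × E => (s, z))
  have hΨsxm : ∀ s x, Measurable (Ψ s x) := fun s x =>
    hΨm.comp ((measurable_const.prodMk (measurable_const.prodMk measurable_id)) :
      Measurable fun v : E => (s, x, v))
  -- `Φ(s, z) = Ψ(0, z) f(s, x + s v, v)`
  set Φ : ℝ → E × E → ℝ := fun s z => Ψ 0 z.1 z.2 * f s (z.1 + s • z.2) z.2 with hΦ
  have hΦc : ∀ z, ContinuousOn (fun s => Φ s z) (Icc 0 T) := fun z =>
    continuousOn_const.mul ((hf.continuousOn_sharp z.1 z.2).mono Icc_subset_Ici_self)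
  have hΦd : ∀ z : E × E, ∀ s ∈ Ioo 0 T, HasDerivAt (fun σ => Φ σ z)
      (Ψ s (z.1 + s • z.2) z.2 * truncatedCollisionOp δ B (f s (z.1 + s • z.2)) z.2) s := by
    intro z s hs
    obtain ⟨hd, heq⟩ := hf.hasDerivAt_sharp hs.1 z.1 z.2
    rw [heq] at hd
    exact (hd.const_mul (Ψ 0 z.1 z.2)).congr_deriv (by rw [hΨT])
  have hint : ∀ s ∈ Icc 0 T, Integrable (fun z : E × E => f s z.1 z.2 * Ψ s z.1 z.2)
      ((volume : Measure E).prod volume) := fun s hs =>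
    hf.integrable_slice_mul_weight hT hs (hΨsm s) (fun z => hWle s hs z.1 z.2)
  -- `Φ(T)` and `Φ(0)` are integrable (the first by the shear at time `T`)
  have hΦT' : Integrable (Φ T) ((volume : Measure E).prod volume) := by
    have h := ((measurePreserving_freeShearEquiv (E := E) T).integrable_comp_emb
      (MeasurableEquiv.measurableEmbedding _) (g := fun y : E × E => f T y.1 y.2 * Ψ T y.1 y.2)).2
      (hint T ⟨hT, le_rfl⟩)
    refine h.congr (Eventually.of_forall fun z => ?_)
    simp only [Function.comp_apply, freeShearEquiv_apply, hΦ, hΨT, mul_comm]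
  have hΦ0' : Integrable (Φ 0) ((volume : Measure E).prod volume) := by
    refine (hint 0 ⟨le_rfl, hT⟩).congr (Eventually.of_forall fun z => ?_)
    simp only [hΦ, zero_smul, add_zero, mul_comm]
  -- the generic identity
  have key := hf.integral_sub_integral_eq_integral_collision hδ hBm hB0 hpoly hT hΨm hWle hΦc
    hΦd hΦT' hΦ0'
  -- the collision contribution vanishes slice by slice
  have hzero : ∀ s ∈ Icc 0 T, ∫ z, Ψ s z.1 z.2 * truncatedCollisionOp δ B (f s z.1) z.2
      ∂((volume : Measure E).prod volume) = 0 := by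
    intro s hs
    have hsl := hf.integrable_weight_mul_truncatedCollisionOp_slice hδ hBm hB0 hpoly hT hΨm hWle hs
    rw [integral_prod _ hsl]
    refine integral_eq_zero_of_ae (Eventually.of_forall fun x => ?_)
    -- `∫ Ψ(s,x,v) Q̃(f)(s,x,v) dv = a ∫ Q(g,g) ψ dv = 0`
    obtain ⟨C_B, k, hBle⟩ := hpoly
    obtain ⟨C_g, -, hC_g⟩ := hf.velocity_decay T hT (Module.finrank ℝ E + k + m + 1)
    have hgm : Measurable (f s x) := (hf.slice_velocity hs.1 x).1.measurable
    have hK := integrable_collisionWeakIntegrand_of_decay hBm hB0 hBle hBk.collide_neg hBk.swap_neg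
      hgm (fun u => hC_g s hs x u) (hΨsxm s x) (C_ψ := C_W * (1 + ‖x‖) ^ m) (m := m)
      (fun u => by have := hWle s hs x u; linarith [this]) (by omega)
    have h0 := integral_collisionOpWith_mul_eq_zero hBk.collide_neg hBk.swap_neg (hΨci s x) hK
    simp only
    calc ∫ v, Ψ s x v * truncatedCollisionOp δ B (f s x) v
        = (1 + δ * ∫ w, |f s x w|)⁻¹ * ∫ v, collisionOpWith B (f s x) (f s x) v * Ψ s x v := by
          rw [← integral_const_mul]
          refine integral_congr_ae (Eventually.of_forall fun v => ?_)
          simp only [truncatedCollisionOp]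
          ring
      _ = 0 := by rw [h0, mul_zero]
  have hrhs : ∫ s in Ioc 0 T, ∫ z, Ψ s z.1 z.2 * truncatedCollisionOp δ B (f s z.1) z.2
      ∂((volume : Measure E).prod volume) = 0 := by
    refine integral_eq_zero_of_ae ?_
    filter_upwards [ae_restrict_mem measurableSet_Ioc] with s hs
    exact hzero s ⟨hs.1.le, hs.2⟩
  rw [hrhs, sub_eq_zero] at key
  -- undo the shear at time `T` and at time `0`
  have hL : ∫ z, Φ T z ∂((volume : Measure E).prod volume) =
      ∫ z, f T z.1 z.2 * Ψ T z.1 z.2 ∂((volume : Measure E).prod volume) := by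
    have h := (measurePreserving_freeShearEquiv (E := E) T).integral_comp'
      (fun y : E × E => f T y.1 y.2 * Ψ T y.1 y.2)
    rw [← h]
    refine integral_congr_ae (Eventually.of_forall fun z => ?_)
    simp only [freeShearEquiv_apply, hΦ, hΨT, mul_comm]
  have hR : ∫ z, Φ 0 z ∂((volume : Measure E).prod volume) =
      ∫ z, f 0 z.1 z.2 * Ψ 0 z.1 z.2 ∂((volume : Measure E).prod volume) :=
    integral_congr_ae (Eventually.of_forall fun z => by simp only [hΦ, zero_smul, add_zero, mul_comm])
  rw [← hL, ← hR, key]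

omit [FiniteDimensional ℝ E] [MeasurableSpace E] [BorelSpace E] in
/-- The moment of inertia about the free-flight position, `v ↦ ‖x - s v‖²`, is a collision
invariant (it is `‖x‖² - 2s⟪x, v⟫ + s²‖v‖²`; CIP 1994 §5.3 Remark b) after Lemma 5.3.1). [cite: CIPDiluteGases1994, §5.3 Lemma 5.3.1 Remark b)] -/
theorem isCollisionInvariant_norm_sub_smul_sq (x : E) (s : ℝ) :
    IsCollisionInvariant (fun v : E => ‖x - s • v‖ ^ 2) := by
  have h := isCollisionInvariant_quadratic (‖x‖ ^ 2) (s ^ 2) ((-2 * s) • x)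
  have hfun : (fun v : E => ‖x‖ ^ 2 + ⟪(-2 * s) • x, v⟫_ℝ + s ^ 2 * ‖v‖ ^ 2) =
      fun v : E => ‖x - s • v‖ ^ 2 := by
    funext v
    rw [norm_sub_sq_real, inner_smul_left, inner_smul_right, norm_smul, Real.norm_eq_abs,
      mul_pow, sq_abs]
    simp only [conj_trivial]
    ring
  rwa [hfun] at h

omit [FiniteDimensional ℝ E] [MeasurableSpace E] [BorelSpace E] in
/-- The kinetic energy `v ↦ ‖v‖²` is a collision invariant. [folklore] -/
theorem isCollisionInvariant_norm_sq : IsCollisionInvariant (fun v : E => ‖v‖ ^ 2) := by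
  intro ω p
  exact norm_sq_collide_fst_add_norm_sq_collide_snd ω p

omit [FiniteDimensional ℝ E] [MeasurableSpace E] [BorelSpace E] in
/-- Constants are collision invariants. [folklore] -/
theorem isCollisionInvariant_const (c : ℝ) : IsCollisionInvariant (fun _ : E => c) :=
  fun _ _ => rfl

/-- **Discharge of `approximateSolution_conservation`** (CIP 1994 §5.3 Lemma 5.3.1 (3.4)–(3.6),
p. 141: conservation of mass, kinetic energy and of the moment `∫∫ f |x - t v|²` for the smooth
rapidly decaying solutions of the truncated equation): the weights `1`, `|v|²`, `|x - t v|²` are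
transport invariant and collision invariants in `v`, so
`integral_mul_eq_of_transport_collision_invariant` applies. [cite: CIPDiluteGases1994, §5.3 Lemma 5.3.1 (3.4)–(3.6)] -/
theorem approximateSolution_conservation_holds : approximateSolution_conservation.{u} := by
  intro E _ _ _ _ _ δ B f hδ hBk hpoly hf t ht
  have hd : ∀ s ≥ (0 : ℝ), IsTruncatedProblemData (f s) := fun s hs =>
    hf.isTruncatedProblemData_slice s hs
  refine ⟨?_, ?_, ?_⟩
  · -- (3.4) mass: `Ψ ≡ 1`
    have h := hf.integral_mul_eq_of_transport_collision_invariant hδ hBk hpoly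
      (Ψ := fun _ _ _ => (1 : ℝ)) measurable_const (fun _ _ _ => rfl)
      (fun _ _ => isCollisionInvariant_const 1)
      (fun T _ => ⟨1, 0, fun s _ x v => by simp⟩) t ht
    simp only [mul_one] at h
    rw [(hd t ht).totalMass_eq_integral, (hd 0 le_rfl).totalMass_eq_integral, h]
  · -- (3.5) kinetic energy: `Ψ = |v|²`
    have h := hf.integral_mul_eq_of_transport_collision_invariant hδ hBk hpoly
      (Ψ := fun _ _ v => ‖v‖ ^ 2) (by fun_prop) (fun _ _ _ => rfl)
      (fun _ _ => isCollisionInvariant_norm_sq)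
      (fun T _ => ⟨1, 2, fun s _ x v => ?_⟩) t ht
    · exact h
    · rw [abs_of_nonneg (sq_nonneg _), one_mul]
      have h1 : (1 : ℝ) ≤ (1 + ‖x‖) ^ 2 := one_le_pow₀ (by linarith [norm_nonneg x])
      nlinarith [norm_nonneg v, sq_nonneg ‖v‖]
  · -- (3.6) moment of inertia about the free-flight position: `Ψ = |x - s v|²`
    have h := hf.integral_mul_eq_of_transport_collision_invariant hδ hBk hpoly
      (Ψ := fun s x v => ‖x - s • v‖ ^ 2) (by fun_prop)
      (fun s x v => by simp) (fun s x => isCollisionInvariant_norm_sub_smul_sq x s)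
      (fun T hT => ⟨(1 + T) ^ 2, 2, fun s hs x v => ?_⟩) t ht
    · simpa using h
    · rw [abs_of_nonneg (sq_nonneg _)]
      have hs0 : 0 ≤ s := hs.1
      have hsT : s ≤ T := hs.2
      have h1 : ‖x - s • v‖ ≤ (1 + T) * ((1 + ‖x‖) * (1 + ‖v‖)) := by
        calc ‖x - s • v‖ ≤ ‖x‖ + ‖s • v‖ := norm_sub_le _ _
          _ = ‖x‖ + s * ‖v‖ := by rw [norm_smul, Real.norm_of_nonneg hs0]
          _ ≤ (1 + T) * ((1 + ‖x‖) * (1 + ‖v‖)) := by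
              nlinarith [norm_nonneg x, norm_nonneg v, mul_nonneg hs0 (norm_nonneg v),
                mul_nonneg (norm_nonneg x) (norm_nonneg v), mul_le_mul_of_nonneg_right hsT (norm_nonneg v)]
      calc ‖x - s • v‖ ^ 2 ≤ ((1 + T) * ((1 + ‖x‖) * (1 + ‖v‖))) ^ 2 :=
            pow_le_pow_left₀ (norm_nonneg _) h1 2
        _ = (1 + T) ^ 2 * (1 + ‖x‖) ^ 2 * (1 + ‖v‖) ^ 2 := by ring

end Conservation

/-! ## The entropy identity (CIP 1994 Lemma 5.3.1, (3.7)) -/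

section Entropy

variable {E : Type*} [NormedAddCommGroup E] [InnerProductSpace ℝ E] [FiniteDimensional ℝ E]
  [MeasurableSpace E] [BorelSpace E]

/-- Lebesgue measure on `(0, T] × E` is the product of its factors. [folklore] -/
theorem volume_restrict_Ioc_prod_univ' (T : ℝ) :
    ((volume : Measure ℝ).prod (volume : Measure E)).restrict (Ioc 0 T ×ˢ univ) =
      ((volume : Measure ℝ).restrict (Ioc 0 T)).prod (volume : Measure E) := by
  rw [← Measure.restrict_univ (μ := (volume : Measure E)), Measure.prod_restrict,
    Measure.restrict_univ]

/-- Almost every point of `(0, T] × E` has its time coordinate in `(0, T]`. [folklore] -/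
theorem ae_fst_mem_Ioc' (T : ℝ) :
    ∀ᵐ p : ℝ × E ∂((volume : Measure ℝ).restrict (Ioc 0 T)).prod (volume : Measure E),
      p.1 ∈ Ioc 0 T := by
  rw [← volume_restrict_Ioc_prod_univ']
  filter_upwards [ae_restrict_mem (measurableSet_Ioc.prod MeasurableSet.univ)] with p hp
  exact hp.1

/-- Polynomial bounds for the entropy weights `log f` and `1 + log f` of an approximate solution on
`[0, T]`. [folklore] -/
theorem IsDiPernaLionsApproximateSolution.exists_abs_log_weight_le {δ : ℝ}
    {B : E × E → sphere (0 : E) 1 → ℝ} {f : ℝ → E → E → ℝ}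
    (hf : IsDiPernaLionsApproximateSolution δ B f) (T : ℝ) (hT : 0 ≤ T) :
    ∃ C_W : ℝ, ∃ m : ℕ, ∀ s ∈ Icc 0 T, ∀ x v,
      |log (f s x v)| ≤ C_W * (1 + ‖x‖) ^ m * (1 + ‖v‖) ^ m ∧
      |1 + log (f s x v)| ≤ C_W * (1 + ‖x‖) ^ m * (1 + ‖v‖) ^ m := by
  obtain ⟨C, k, hCk⟩ := hf.abs_log_le T hT
  refine ⟨1 + |C|, k, fun s hs x v => ?_⟩
  have hP1 : (1 : ℝ) ≤ (1 + ‖x‖) ^ k * (1 + ‖v‖) ^ k :=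
    one_le_mul_of_one_le_of_one_le (one_le_pow₀ (by linarith [norm_nonneg x]))
      (one_le_pow₀ (by linarith [norm_nonneg v]))
  have hle : (1 + ‖x‖ + ‖v‖) ^ k ≤ (1 + ‖x‖) ^ k * (1 + ‖v‖) ^ k := by
    rw [← mul_pow]
    exact pow_le_pow_left₀ (by positivity) (by nlinarith [norm_nonneg x, norm_nonneg v]) k
  have h1 : |log (f s x v)| ≤ |C| * ((1 + ‖x‖) ^ k * (1 + ‖v‖) ^ k) :=
    (hCk s hs x v).trans ((mul_le_mul_of_nonneg_right (le_abs_self C) (by positivity)).trans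
      (mul_le_mul_of_nonneg_left hle (abs_nonneg C)))
  constructor
  · calc |log (f s x v)| ≤ |C| * ((1 + ‖x‖) ^ k * (1 + ‖v‖) ^ k) := h1
      _ ≤ (1 + |C|) * ((1 + ‖x‖) ^ k * (1 + ‖v‖) ^ k) := by gcongr; linarith [abs_nonneg C]
      _ = (1 + |C|) * (1 + ‖x‖) ^ k * (1 + ‖v‖) ^ k := by ring
  · calc |1 + log (f s x v)| ≤ 1 + |log (f s x v)| := by
          refine (abs_add_le _ _).trans ?_; rw [abs_one]
      _ ≤ 1 * ((1 + ‖x‖) ^ k * (1 + ‖v‖) ^ k) + |C| * ((1 + ‖x‖) ^ k * (1 + ‖v‖) ^ k) := by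
          rw [one_mul]; exact add_le_add hP1 h1
      _ = (1 + |C|) * (1 + ‖x‖) ^ k * (1 + ‖v‖) ^ k := by ring

/-- **The entropy production of a slice of an approximate solution**: for `s ∈ [0, T]` and every
`x`, the entropy-production integrand of the velocity density `f(s, x, ·)` is integrable and
`∫ (1 + log f(s,x,v)) Q̃_δ(f,f)(s,x,v) dv = -(1 + δ ∫ f(s,x,·))⁻¹ D_B(f(s,x,·))`
(CIP 1994 §5.3 proof of (3.7): "let `φ = ln f` in (3.10)"; the constant `1` is annihilated). [cite: CIPDiluteGases1994, §5.3 Lemma 5.3.1 (3.7)] -/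
theorem IsDiPernaLionsApproximateSolution.integral_one_add_log_mul_truncatedCollisionOp {δ : ℝ}
    {B : E × E → sphere (0 : E) 1 → ℝ} {f : ℝ → E → E → ℝ}
    (hf : IsDiPernaLionsApproximateSolution δ B f) (hBk : KineticTheory.IsDiPernaLionsKernel B)
    (hpoly : ∃ C : ℝ, ∃ k : ℕ, ∀ p ω, B p ω ≤ C * (1 + ‖p.1 - p.2‖) ^ k) {T : ℝ} (hT : 0 ≤ T)
    {s : ℝ} (hs : s ∈ Icc 0 T) (x : E) :
    Integrable (entropyProductionIntegrand B (f s x))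
        (((volume : Measure E).prod volume).prod sphereMeasure) ∧
      ∫ v, (1 + log (f s x v)) * truncatedCollisionOp δ B (f s x) v =
        -((1 + δ * ∫ w, |f s x w|)⁻¹ * entropyProduction B (f s x)) := by
  obtain ⟨C_B, k, hBle⟩ := hpoly
  obtain ⟨C_L, m, hCL⟩ := hf.exists_abs_log_weight_le T hT
  obtain ⟨C_g, -, hC_g⟩ := hf.velocity_decay T hT (Module.finrank ℝ E + k + m + 1)
  have hgm : Measurable (f s x) := (hf.slice_velocity hs.1 x).1.measurable
  have hpos : ∀ v, 0 < f s x v := fun v => hf.pos s hs.1 x v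
  have hKlog := integrable_collisionWeakIntegrand_of_decay hBk.measurable hBk.nonneg hBle
    hBk.collide_neg hBk.swap_neg hgm (fun u => hC_g s hs x u) (Real.measurable_log.comp hgm)
    (C_ψ := C_L * (1 + ‖x‖) ^ m) (m := m) (fun u => (hCL s hs x u).1) (by omega)
  have hK1log := integrable_collisionWeakIntegrand_of_decay hBk.measurable hBk.nonneg hBle
    hBk.collide_neg hBk.swap_neg hgm (fun u => hC_g s hs x u)
    (measurable_const.add (Real.measurable_log.comp hgm))
    (ψ := fun u => 1 + log (f s x u))
    (C_ψ := C_L * (1 + ‖x‖) ^ m) (m := m) (fun u => (hCL s hs x u).2) (by omega)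
  refine ⟨(integrable_entropyProduction_integrand hBk.collide_neg hBk.swap_neg hpos hKlog).congr
    (Eventually.of_forall fun q => rfl), ?_⟩
  have hH := integral_collisionOpWith_mul_const_add_log_eq hBk.collide_neg hBk.swap_neg hpos 1 hK1log
  calc ∫ v, (1 + log (f s x v)) * truncatedCollisionOp δ B (f s x) v
      = (1 + δ * ∫ w, |f s x w|)⁻¹ *
          ∫ v, collisionOpWith B (f s x) (f s x) v * (1 + log (f s x v)) := by
        rw [← integral_const_mul]
        refine integral_congr_ae (Eventually.of_forall fun v => ?_)
        simp only [truncatedCollisionOp]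
        ring
    _ = -((1 + δ * ∫ w, |f s x w|)⁻¹ * entropyProduction B (f s x)) := by rw [hH, mul_neg]

/-- The normalised dissipation of a slice `s ≥ 0` of an approximate solution, as a real number:
`ẽ(f)(s, x) = ENNReal.ofReal ((1 + δ ∫ f(s,x,·))⁻¹ D_B(f(s,x,·)))`, and this real number is
nonnegative. [folklore] -/
theorem IsDiPernaLionsApproximateSolution.eTruncatedEntropyProduction_eq_ofReal {δ : ℝ}
    {B : E × E → sphere (0 : E) 1 → ℝ} {f : ℝ → E → E → ℝ}
    (hf : IsDiPernaLionsApproximateSolution δ B f) (hδ : 0 ≤ δ)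
    (hBk : KineticTheory.IsDiPernaLionsKernel B)
    (hpoly : ∃ C : ℝ, ∃ k : ℕ, ∀ p ω, B p ω ≤ C * (1 + ‖p.1 - p.2‖) ^ k) {T : ℝ} (hT : 0 ≤ T)
    {s : ℝ} (hs : s ∈ Icc 0 T) (x : E) :
    eTruncatedEntropyProduction δ B (f s x) =
        ENNReal.ofReal ((1 + δ * ∫ w, |f s x w|)⁻¹ * entropyProduction B (f s x)) ∧
      0 ≤ (1 + δ * ∫ w, |f s x w|)⁻¹ * entropyProduction B (f s x) := by
  have hpos : ∀ v, 0 < f s x v := fun v => hf.pos s hs.1 x v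
  obtain ⟨ha0, -⟩ := normalisingFactor_pos_and_le_one hδ (f s x)
  obtain ⟨hEPI, -⟩ := hf.integral_one_add_log_mul_truncatedCollisionOp hBk hpoly hT hs x
  refine ⟨?_, mul_nonneg ha0.le (entropyProduction_nonneg hBk.nonneg hpos)⟩
  rw [eTruncatedEntropyProduction, eEntropyProduction_eq_ofReal hBk.nonneg hpos hEPI,
    ← ENNReal.ofReal_mul ha0.le]

/-- **Discharge of `approximateSolution_entropy_identity`** (CIP 1994 §5.3 Lemma 5.3.1 (3.7),
p. 141: the `H`-theorem identity `H(f(t)) + ∫₀ᵗ ∫∫ ẽ(f) dx dv ds = H(f(0))` for the smooth rapidly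
decaying solutions of the truncated equation, with the normalised dissipation (3.24)). Proof:
`d/ds [f♯ log f♯] = (1 + log f♯) Q̃_δ(f,f)♯` along characteristics; integrate over phase space
and exchange the integrals (`integral_sub_integral_eq_integral_collision`); on each slice,
`∫ (1 + log f) Q̃_δ(f,f) dv = -(1 + δ∫f)⁻¹ D_B(f)` by the weak formulation with `φ = ln f`; the
`ℝ≥0∞`-valued dissipation of the statement is identified with this integrable nonnegative function.
[cite: CIPDiluteGases1994, §5.3 Lemma 5.3.1 (3.7)] -/
theorem approximateSolution_entropy_identity_holds : approximateSolution_entropy_identity.{u} := by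
  intro E _ _ _ _ _ δ B f hδ hBk hpoly hf t ht
  have hBm := hBk.measurable
  have hB0 := hBk.nonneg
  have hd : ∀ s ≥ (0 : ℝ), IsTruncatedProblemData (f s) := fun s hs =>
    hf.isTruncatedProblemData_slice s hs
  -- the weight `W = 1 + log f` (through the time clamp) and its polynomial bound on `[0, t]`
  set W : ℝ → E → E → ℝ := fun s x v => 1 + log (f (max s 0) x v) with hW
  have hfc : Continuous fun q : ℝ × E × E => f (max q.1 0) q.2.1 q.2.2 :=
    hf.continuous_clamp continuous_fst (continuous_fst.comp continuous_snd)
      (continuous_snd.comp continuous_snd)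
  have hWm : Measurable fun q : ℝ × E × E => W q.1 q.2.1 q.2.2 :=
    (continuous_const.add (hfc.log fun q => (hf.pos _ (le_max_right _ _) _ _).ne')).measurable
  obtain ⟨C_W, m, hCW⟩ := hf.exists_abs_log_weight_le t ht
  have hWle : ∀ s ∈ Icc 0 t, ∀ x v, |W s x v| ≤ C_W * (1 + ‖x‖) ^ m * (1 + ‖v‖) ^ m := by
    intro s hs x v
    simp only [hW, max_eq_left hs.1]
    exact (hCW s hs x v).2
  -- `Φ(s, z) = (f log f)(s, x + s v, v)`
  set Φ : ℝ → E × E → ℝ := fun s z =>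
    f s (z.1 + s • z.2) z.2 * log (f s (z.1 + s • z.2) z.2) with hΦ
  have hΦc : ∀ z, ContinuousOn (fun s => Φ s z) (Icc 0 t) := by
    intro z
    have hF : ContinuousOn (fun s : ℝ => f s (z.1 + s • z.2) z.2) (Icc 0 t) :=
      (hf.continuousOn_sharp z.1 z.2).mono Icc_subset_Ici_self
    exact hF.mul (hF.log fun s hs => (hf.pos s hs.1 _ _).ne')
  have hΦd : ∀ z : E × E, ∀ s ∈ Ioo 0 t, HasDerivAt (fun σ => Φ σ z)
      (W s (z.1 + s • z.2) z.2 * truncatedCollisionOp δ B (f s (z.1 + s • z.2)) z.2) s := by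
    intro z s hs
    obtain ⟨hd', heq⟩ := hf.hasDerivAt_sharp hs.1 z.1 z.2
    rw [heq] at hd'
    have hne : f s (z.1 + s • z.2) z.2 ≠ 0 := (hf.pos s hs.1.le _ _).ne'
    have h := hd'.mul (hd'.log hne)
    refine h.congr_deriv ?_
    simp only [hW, max_eq_left hs.1.le]
    field_simp
    ring
  have hΦT : Integrable (Φ t) ((volume : Measure E).prod volume) := by
    have h := ((measurePreserving_freeShearEquiv (E := E) t).integrable_comp_emb
      (MeasurableEquiv.measurableEmbedding _)
      (g := fun y : E × E => f t y.1 y.2 * log (f t y.1 y.2))).2 (hd t ht).integrable_mul_log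
    refine h.congr (Eventually.of_forall fun z => ?_)
    simp only [Function.comp_apply, freeShearEquiv_apply, hΦ]
  have hΦ0 : Integrable (Φ 0) ((volume : Measure E).prod volume) := by
    refine (hd 0 le_rfl).integrable_mul_log.congr (Eventually.of_forall fun z => ?_)
    simp only [hΦ, zero_smul, add_zero]
  -- the generic identity and the slab integrability of `W Q̃`
  have key := hf.integral_sub_integral_eq_integral_collision hδ hBm hB0 hpoly ht hWm hWle hΦc
    hΦd hΦT hΦ0
  have hHi := hf.integrable_weight_mul_truncatedCollisionOp hδ hBm hB0 hpoly ht hWm hWle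
  -- the real-valued normalised dissipation
  set Dr : ℝ → E → ℝ := fun s x =>
    (1 + δ * ∫ w, |f s x w|)⁻¹ * entropyProduction B (f s x) with hDr
  have hslice : ∀ s ∈ Icc 0 t, ∀ x, ∫ v, W s x v * truncatedCollisionOp δ B (f s x) v = -Dr s x := by
    intro s hs x
    simp only [hW, hDr, max_eq_left hs.1]
    exact (hf.integral_one_add_log_mul_truncatedCollisionOp hBk hpoly ht hs x).2
  have hDr0 : ∀ s ∈ Icc 0 t, ∀ x, 0 ≤ Dr s x := fun s hs x =>
    (hf.eTruncatedEntropyProduction_eq_ofReal hδ hBk hpoly ht hs x).2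
  -- `∫∫ W Q̃ (s) = -∫ Dr(s, x) dx` on each slice
  have hslab : ∀ s ∈ Icc 0 t, ∫ z, W s z.1 z.2 * truncatedCollisionOp δ B (f s z.1) z.2
      ∂((volume : Measure E).prod volume) = -∫ x, Dr s x := by
    intro s hs
    have hsl := hf.integrable_weight_mul_truncatedCollisionOp_slice hδ hBm hB0 hpoly ht hWm hWle hs
    rw [integral_prod _ hsl, ← integral_neg]
    exact integral_congr_ae (Eventually.of_forall fun x => hslice s hs x)
  -- integrability of `Dr` on `(0, t] × E`
  have hDri : Integrable (fun p : ℝ × E => Dr p.1 p.2)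
      (((volume : Measure ℝ).restrict (Ioc 0 t)).prod (volume : Measure E)) := by
    -- reassociate `ℝ × (E × E)` to `(ℝ × E) × E` and integrate out the velocity
    have h1 := ((measurePreserving_prodAssoc ((volume : Measure ℝ).restrict (Ioc 0 t))
      (volume : Measure E) (volume : Measure E)).integrable_comp_emb
      (MeasurableEquiv.measurableEmbedding _)
      (g := fun q : ℝ × E × E => W q.1 q.2.1 q.2.2 * truncatedCollisionOp δ B (f q.1 q.2.1) q.2.2)).2 hHi
    have h2 := h1.integral_prod_left
    have h3 : Integrable (fun p : ℝ × E => ∫ v, W p.1 p.2 v * truncatedCollisionOp δ B (f p.1 p.2) v)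
        (((volume : Measure ℝ).restrict (Ioc 0 t)).prod (volume : Measure E)) := by
      refine h2.congr (Eventually.of_forall fun p => ?_)
      rfl
    refine h3.neg.congr ?_
    filter_upwards [ae_fst_mem_Ioc' (E := E) t] with p hp
    simp only [Pi.neg_apply]
    rw [hslice p.1 ⟨hp.1.le, hp.2⟩ p.2, neg_neg]
  -- the `ℝ≥0∞`-valued dissipation integral
  set I : ℝ := ∫ s in Ioc 0 t, ∫ x, Dr s x with hI
  have hI0 : 0 ≤ I := by
    refine setIntegral_nonneg measurableSet_Ioc fun s hs => integral_nonneg fun x => ?_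
    exact hDr0 s ⟨hs.1.le, hs.2⟩ x
  have hL : (∫⁻ p : ℝ × E in Ioc 0 t ×ˢ univ, eTruncatedEntropyProduction δ B (f p.1 p.2)
      ∂(volume.prod volume)) = ENNReal.ofReal I := by
    have h1 : (∫⁻ p : ℝ × E in Ioc 0 t ×ˢ univ, eTruncatedEntropyProduction δ B (f p.1 p.2)
        ∂(volume.prod volume)) =
        ∫⁻ p : ℝ × E in Ioc 0 t ×ˢ univ, ENNReal.ofReal (Dr p.1 p.2) ∂(volume.prod volume) := by
      refine setLIntegral_congr_fun (measurableSet_Ioc.prod MeasurableSet.univ) fun p hp => ?_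
      exact (hf.eTruncatedEntropyProduction_eq_ofReal hδ hBk hpoly ht ⟨hp.1.1.le, hp.1.2⟩ p.2).1
    rw [h1, volume_restrict_Ioc_prod_univ', ← ofReal_integral_eq_lintegral_ofReal hDri, hI,
      integral_prod _ hDri]
    filter_upwards [ae_fst_mem_Ioc' (E := E) t] with p hp
    exact hDr0 p.1 ⟨hp.1.le, hp.2⟩ p.2
  -- the entropies as phase-space integrals, through the shear at time `t`
  have hHt : boltzmannEntropy (f t) = ∫ z, Φ t z ∂((volume : Measure E).prod volume) := by
    rw [(hd t ht).boltzmannEntropy_eq_integral]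
    have h := (measurePreserving_freeShearEquiv (E := E) t).integral_comp'
      (fun y : E × E => f t y.1 y.2 * log (f t y.1 y.2))
    rw [← h]
    rfl
  have hH0 : boltzmannEntropy (f 0) = ∫ z, Φ 0 z ∂((volume : Measure E).prod volume) := by
    rw [(hd 0 le_rfl).boltzmannEntropy_eq_integral]
    refine integral_congr_ae (Eventually.of_forall fun z => ?_)
    simp only [hΦ, zero_smul, add_zero]
  -- assemble
  have hkey' : (∫ z, Φ t z ∂((volume : Measure E).prod volume)) -
      ∫ z, Φ 0 z ∂((volume : Measure E).prod volume) = -I := by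
    rw [key, hI, ← integral_neg]
    refine setIntegral_congr_fun measurableSet_Ioc fun s hs => ?_
    exact hslab s ⟨hs.1.le, hs.2⟩
  refine ⟨by rw [hL]; exact ENNReal.ofReal_ne_top, ?_⟩
  rw [hL, ENNReal.toReal_ofReal hI0, hHt, hH0]
  linarith

end Entropy

end Literature.MathematicalPhysics.KineticTheory
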